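import Summits.AtomisticToContinuum.Crystallization.Theses.ChessboardParticlePlanes
import Summits.AtomisticToContinuum.Crystallization.Theorems.LaminarSixThreeThreeHcpWindowsToPeriodicWindows
import Literature.MathematicalPhysics.StatisticalMechanics.MuGroundStateConfiguration
import Literature.MathematicalPhysics.StatisticalMechanics.BarlowStacking
import Literature.MathematicalPhysics.StatisticalMechanics.HcpHomogeneous
import Literature.MathematicalPhysics.StatisticalMechanics.CrystallizationSymmetries

/-!
# Crux `PeriodicWindows` (stmt-AtomisticToContinuum-3240), line `Sketch` — stub S5

Stub `stub_hcpHullPointGivesWindows`, step S5 of the lead skeleton `PeriodicWindowsSketch`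
(compactness glue): an exact rigid image `X = B (hcpStacking a h) + τ` of a relaxed hexagonal close
packing in the ROTATED hull of a sequence `x` of configurations (`X` is the local two-way-matching
limit, `BallMatch` on every ball, of `A j (x (σ j) ·) + τ' j` along a strictly increasing `σ`,
`A j` linear isometries) gives ONE periodic configuration `P` whose `(R, ε)`-windows are matched,
frequently in `N`, by translates `x N + t`.

Proof: the argument of `hcpWindowsToPeriodicWindows_proof` (route `LaminarSixThreeThree`) for one
sequence and FIXED spacings `(a, h)`.  Per `k`, hull membership at radius `‖s₀‖ + k + 3` and
tolerance `1/(2(k+5))` (with `s₀ = B p₀ + τ` the image of a base site `p₀`) together with HCP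
homogeneity (`hcpStacking_homogeneous`) gives an index `N ≥ k`, a centre particle `i` and a linear
isometry `T` (a continuous linear map, `T = (A j)⁻¹ ∘ B ∘ B'`) such that the `(k+1)`-window of
`x N` about `x N i` is `1/(k+5)`-matched both ways with `x N i + T (hcpStacking a h)`.  The linear
isometries of `ℝ³` form a compact set (`isCompact_setOf_norm_map_eq`), so `T → T₀` along a
subsequence; `P := T₀ (hcpPeriodicConfiguration a h)` (`PeriodicConfiguration.isometryImage`) is
matched on every `(R, ε)`-window by the translates `x N - x N i` for all large indices of the
subsequence (operator-norm control of `T - T₀` on the bounded window).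
-/

noncomputable section

namespace Summit.AtomisticToContinuum.Crystallization.Theorems.PeriodicWindowsSketch

open Literature.MathematicalPhysics.StatisticalMechanics Filter

/-- STUB S5 (compactness glue): an exact rigid image of a relaxed hcp in the rotated hull of `x`
gives ONE periodic configuration matched, frequently in `N`, by translates of `x` (per-`k` windows
from hull membership and HCP homogeneity; compactness of the linear isometries of `ℝ³`,
`isCompact_setOf_norm_map_eq`; `P` = isometry image of `hcpPeriodicConfiguration a h` under the
limit isometry — the argument of `hcpWindowsToPeriodicWindows_proof` for one sequence and fixed
`(a, h)`). -/
theorem stub_hcpHullPointGivesWindows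
    (x : (N : ℕ) → (Fin N → EuclideanSpace ℝ (Fin 3)))
    (hhcp : ∃ (X : Set (EuclideanSpace ℝ (Fin 3))) (a h : ℝ) (ha : a ≠ 0) (hh : h ≠ 0)
      (B : EuclideanSpace ℝ (Fin 3) ≃ₗᵢ[ℝ] EuclideanSpace ℝ (Fin 3)) (τ : EuclideanSpace ℝ (Fin 3)),
      (∃ (σ : ℕ → ℕ) (τ' : ℕ → EuclideanSpace ℝ (Fin 3))
          (A : ℕ → (EuclideanSpace ℝ (Fin 3) ≃ₗᵢ[ℝ] EuclideanSpace ℝ (Fin 3))),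
        StrictMono σ ∧ ∀ R ε : ℝ, 0 < ε → ∀ᶠ j in Filter.atTop,
          BallMatch ε R 0 (Set.range fun i => A j (x (σ j) i) + τ' j) X) ∧
      X = (fun p => B p + τ) '' (hcpPeriodicConfiguration ha hh).points) :
    ∃ P : PeriodicConfiguration 3, ∀ R ε : ℝ, 0 < ε → ∃ᶠ N in Filter.atTop,
      ∃ t : EuclideanSpace ℝ (Fin 3),
        (∀ s ∈ P.points, ‖s‖ ≤ R → ∃ i : Fin N, dist (x N i + t) s ≤ ε) ∧
        (∀ i : Fin N, ‖x N i + t‖ ≤ R → ∃ s ∈ P.points, dist (x N i + t) s ≤ ε) := by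
  obtain ⟨X, a, h, ha, hh, B, τ, ⟨σ, τ', A, hσ, hmatch⟩, rfl⟩ := hhcp
  -- Step 0: the points of the hcp image, a base site `p₀` and HCP homogeneity at `p₀`.
  have hXin : ∀ q ∈ hcpStacking a h,
      B q + τ ∈ (fun p => B p + τ) '' (hcpPeriodicConfiguration ha hh).points := fun q hq =>
    ⟨q, by rw [hcpPeriodicConfiguration_points]; exact hq, rfl⟩
  have hXout : ∀ s ∈ (fun p => B p + τ) '' (hcpPeriodicConfiguration ha hh).points,
      ∃ q ∈ hcpStacking a h, s = B q + τ := by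
    rintro s ⟨q, hq, rfl⟩
    rw [hcpPeriodicConfiguration_points] at hq
    exact ⟨q, hq, rfl⟩
  obtain ⟨p₀, hp₀⟩ : ∃ p₀, p₀ ∈ hcpStacking a h := ⟨_, barlowPos_mem 0 0 0⟩
  obtain ⟨B', hB'⟩ := hcpStacking_homogeneous a h hp₀
  -- Step 1: along `(R_k, ε_k) = (k + 1, 1/(k + 5))`, a two-way matched window at some `N ≥ k`,
  -- centred at a particle `i` and carried by a linear isometry `T`.
  have step : ∀ k : ℕ, ∃ N : ℕ, k ≤ N ∧ ∃ i : Fin N,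
      ∃ T : EuclideanSpace ℝ (Fin 3) →L[ℝ] EuclideanSpace ℝ (Fin 3),
        (∀ v, ‖T v‖ = ‖v‖) ∧
        (∀ q ∈ hcpStacking a h, ‖q‖ ≤ (k : ℝ) + 1 →
          ∃ j : Fin N, dist (x N j) (x N i + T q) ≤ 1 / ((k : ℝ) + 5)) ∧
        (∀ j : Fin N, dist (x N j) (x N i) ≤ (k : ℝ) + 1 →
          ∃ q ∈ hcpStacking a h, dist (x N j) (x N i + T q) ≤ 1 / ((k : ℝ) + 5)) := by
    intro k
    have hk0 : (0 : ℝ) ≤ k := k.cast_nonneg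
    have hε : (0 : ℝ) < 1 / ((k : ℝ) + 5) / 2 := by positivity
    have hε2 : 1 / ((k : ℝ) + 5) / 2 ≤ 2 := by
      rw [div_le_iff₀ two_pos, div_le_iff₀ (by positivity)]
      linarith
    obtain ⟨j, hkj, hBM⟩ := ((eventually_ge_atTop k).and
      (hmatch (‖B p₀ + τ‖ + ((k : ℝ) + 3)) (1 / ((k : ℝ) + 5) / 2) hε)).exists
    have hkN : k ≤ σ j := hkj.trans (hσ.id_le j)
    -- the centre particle `i`: the particle matched to the base point `B p₀ + τ`
    obtain ⟨_, ⟨i, rfl⟩, hi⟩ := hBM.1 (B p₀ + τ) (hXin p₀ hp₀)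
      (by rw [dist_zero_right]; linarith)
    have hi : dist (A j (x (σ j) i) + τ' j) (B p₀ + τ) ≤ 1 / ((k : ℝ) + 5) / 2 := hi
    -- the linear isometry `T = (A j)⁻¹ ∘ B ∘ B'`
    obtain ⟨T, hTn, hTA⟩ : ∃ T : EuclideanSpace ℝ (Fin 3) →L[ℝ] EuclideanSpace ℝ (Fin 3),
        (∀ v, ‖T v‖ = ‖v‖) ∧ ∀ v, A j (T v) = B (B' v) :=
      ⟨(B'.trans (B.trans (A j).symm)).toLinearIsometry.toContinuousLinearMap,
        fun v => LinearIsometry.norm_map _ v, fun v => by simp⟩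
    have hkey : ∀ (l : Fin (σ j)) (v : EuclideanSpace ℝ (Fin 3)),
        dist (x (σ j) l) (x (σ j) i + T v) =
          dist (A j (x (σ j) l) + τ' j) (A j (x (σ j) i) + τ' j + B (B' v)) := by
      intro l v
      rw [← (A j).dist_map, map_add, hTA, ← dist_add_right _ _ (τ' j), add_right_comm]
    refine ⟨σ j, hkN, i, T, hTn, ?_, ?_⟩
    · -- sites near particles
      intro q hq hqk
      have hp : p₀ + B' q ∈ hcpStacking a h := (hB' q).1 hq
      have hs : B (p₀ + B' q) + τ = B p₀ + τ + B (B' q) := by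
        rw [map_add]
        abel
      obtain ⟨_, ⟨l, rfl⟩, hl⟩ := hBM.1 _ (hXin _ hp) (by
        rw [dist_zero_right, hs]
        calc ‖B p₀ + τ + B (B' q)‖ ≤ ‖B p₀ + τ‖ + ‖B (B' q)‖ := norm_add_le _ _
          _ = ‖B p₀ + τ‖ + ‖q‖ := by rw [B.norm_map, B'.norm_map]
          _ ≤ ‖B p₀ + τ‖ + ((k : ℝ) + 3) := by linarith)
      refine ⟨l, ?_⟩
      rw [hkey]
      calc dist (A j (x (σ j) l) + τ' j) (A j (x (σ j) i) + τ' j + B (B' q))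
          ≤ dist (A j (x (σ j) l) + τ' j) (B (p₀ + B' q) + τ) +
            dist (B (p₀ + B' q) + τ) (A j (x (σ j) i) + τ' j + B (B' q)) := dist_triangle _ _ _
        _ = dist (A j (x (σ j) l) + τ' j) (B (p₀ + B' q) + τ) +
            dist (A j (x (σ j) i) + τ' j) (B p₀ + τ) := by
            rw [hs, dist_add_right, dist_comm (B p₀ + τ)]
        _ ≤ 1 / ((k : ℝ) + 5) / 2 + 1 / ((k : ℝ) + 5) / 2 := add_le_add hl hi
        _ = 1 / ((k : ℝ) + 5) := add_halves _
    · -- particles near sites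
      intro l hl
      have hnorm : dist (A j (x (σ j) l) + τ' j) 0 ≤ ‖B p₀ + τ‖ + ((k : ℝ) + 3) :=
        calc dist (A j (x (σ j) l) + τ' j) 0
            ≤ dist (A j (x (σ j) l) + τ' j) (A j (x (σ j) i) + τ' j) +
              (dist (A j (x (σ j) i) + τ' j) (B p₀ + τ) + dist (B p₀ + τ) 0) :=
              (dist_triangle _ _ _).trans (add_le_add le_rfl (dist_triangle _ _ _))
          _ = dist (x (σ j) l) (x (σ j) i) +
              (dist (A j (x (σ j) i) + τ' j) (B p₀ + τ) + ‖B p₀ + τ‖) := by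
              rw [dist_add_right, (A j).dist_map, dist_zero_right]
          _ ≤ ((k : ℝ) + 1) + (1 / ((k : ℝ) + 5) / 2 + ‖B p₀ + τ‖) := by gcongr
          _ ≤ ‖B p₀ + τ‖ + ((k : ℝ) + 3) := by linarith
      obtain ⟨s, hs, hls⟩ := hBM.2 (A j (x (σ j) l) + τ' j) ⟨l, rfl⟩ hnorm
      obtain ⟨q₁, hq₁, rfl⟩ := hXout s hs
      refine ⟨B'.symm (q₁ - p₀), (hB' _).2 (by simpa using hq₁), ?_⟩
      rw [hkey]
      have hs' : A j (x (σ j) i) + τ' j + B (B' (B'.symm (q₁ - p₀))) =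
          B q₁ + τ + ((A j (x (σ j) i) + τ' j) - (B p₀ + τ)) := by
        rw [B'.apply_symm_apply, map_sub]
        abel
      calc dist (A j (x (σ j) l) + τ' j) (A j (x (σ j) i) + τ' j + B (B' (B'.symm (q₁ - p₀))))
          ≤ dist (A j (x (σ j) l) + τ' j) (B q₁ + τ) +
            dist (B q₁ + τ) (A j (x (σ j) i) + τ' j + B (B' (B'.symm (q₁ - p₀)))) :=
            dist_triangle _ _ _
        _ = dist (A j (x (σ j) l) + τ' j) (B q₁ + τ) +
            dist (A j (x (σ j) i) + τ' j) (B p₀ + τ) := by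
            rw [hs', dist_self_add_right, dist_eq_norm (A j (x (σ j) i) + τ' j)]
        _ ≤ 1 / ((k : ℝ) + 5) / 2 + 1 / ((k : ℝ) + 5) / 2 := add_le_add hls hi
        _ = 1 / ((k : ℝ) + 5) := add_halves _
  -- Step 2: choose the data along `k`.
  choose N hN i T hT hW1 hW2 using step
  -- Step 3: compactness of the linear isometries and a convergent subsequence `T ∘ φ → T₀`.
  have hu : ∀ k, T k ∈ {T : EuclideanSpace ℝ (Fin 3) →L[ℝ] EuclideanSpace ℝ (Fin 3) |
      ∀ v, ‖T v‖ = ‖v‖} := fun k => hT k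
  obtain ⟨T₀, hT₀, φ, hφ, hlim⟩ := isCompact_setOf_norm_map_eq.tendsto_subseq hu
  simp only [Set.mem_setOf_eq] at hT₀
  -- Step 4: the periodic configuration `P = T₀ (HCP(a, h))`.
  obtain ⟨Te, hTe⟩ : ∃ Te : EuclideanSpace ℝ (Fin 3) ≃ₗᵢ[ℝ] EuclideanSpace ℝ (Fin 3),
      ∀ v, Te v = T₀ v :=
    ⟨(⟨T₀.toLinearMap, hT₀⟩ : EuclideanSpace ℝ (Fin 3) →ₗᵢ[ℝ] EuclideanSpace ℝ (Fin 3)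
        ).toLinearIsometryEquiv rfl, fun _ => rfl⟩
  refine ⟨(hcpPeriodicConfiguration ha hh).isometryImage Te, ?_⟩
  have hpts : ∀ s, s ∈ ((hcpPeriodicConfiguration ha hh).isometryImage Te).points ↔
      ∃ q ∈ hcpStacking a h, s = T₀ q := by
    intro s
    rw [PeriodicConfiguration.mem_points_isometryImage, hcpPeriodicConfiguration_points]
    constructor
    · intro hs
      exact ⟨Te.symm s, hs, by rw [← hTe, Te.apply_symm_apply]⟩
    · rintro ⟨q, hq, rfl⟩
      rw [← hTe, Te.symm_apply_apply]
      exact hq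
  -- Step 5: matching of every `(R, ε)`-window, frequently in `N`.
  intro R ε hε
  rw [Filter.frequently_atTop]
  intro M
  set R' : ℝ := max R 0 + 1
  have hR0 : 0 ≤ max R 0 := le_max_right _ _
  have hRR : R ≤ max R 0 := le_max_left _ _
  have hR'pos : 0 < R' := by positivity
  set η : ℝ := ε / (2 * R') with hη
  have hηpos : 0 < η := by positivity
  have hηR' : η * R' = ε / 2 := by
    rw [hη]
    field_simp
  have hevk : ∀ᶠ k : ℕ in atTop, (M ≤ k ∧ max R 0 ≤ (k : ℝ) ∧ 2 / ε ≤ (k : ℝ)) ∧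
      dist (T (φ k)) T₀ < η := by
    refine ((eventually_ge_atTop M).and
      ((tendsto_natCast_atTop_atTop.eventually_ge_atTop (max R 0)).and
        (tendsto_natCast_atTop_atTop.eventually_ge_atTop (2 / ε)))).and ?_
    exact Metric.tendsto_nhds.1 hlim η hηpos
  obtain ⟨k, ⟨hkM, hkR, hkε⟩, hkT⟩ := hevk.exists
  rw [dist_eq_norm] at hkT
  set n := φ k
  have hkn : k ≤ n := hφ.id_le k
  have hkn' : (k : ℝ) ≤ n := by exact_mod_cast hkn
  have h2 : 2 ≤ ε * k := (div_le_iff₀' hε).1 hkε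
  have hεn : 1 / ((n : ℝ) + 5) ≤ ε / 2 := by
    rw [div_le_iff₀ (by positivity)]
    have : ε * k ≤ ε * n := mul_le_mul_of_nonneg_left hkn' hε.le
    nlinarith
  have hεn5 : 1 / ((n : ℝ) + 5) ≤ 1 / 5 :=
    one_div_le_one_div_of_le (by norm_num) (by linarith [(n.cast_nonneg : (0 : ℝ) ≤ n)])
  -- operator-norm control of `T n - T₀` on vectors
  have hTv : ∀ v : EuclideanSpace ℝ (Fin 3), ‖T n v - T₀ v‖ ≤ η * ‖v‖ := fun v => by
    rw [← sub_apply]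
    exact ((T n - T₀).le_opNorm v).trans (mul_le_mul_of_nonneg_right hkT.le (norm_nonneg v))
  -- a particle `1/(n+5)`-close to `x i + T n q`, `‖q‖ ≤ R'`, is `ε`-close to `x i + T₀ q`
  have hclose : ∀ (j : Fin (N n)) (q : EuclideanSpace ℝ (Fin 3)),
      dist (x (N n) j) (x (N n) (i n) + T n q) ≤ 1 / ((n : ℝ) + 5) → ‖q‖ ≤ R' →
        dist (x (N n) j + -x (N n) (i n)) (T₀ q) ≤ ε := by
    intro j q hj hq
    calc dist (x (N n) j + -x (N n) (i n)) (T₀ q)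
        = dist (x (N n) j) (x (N n) (i n) + T₀ q) := by
          rw [dist_eq_norm, dist_eq_norm]
          congr 1
          abel
      _ ≤ dist (x (N n) j) (x (N n) (i n) + T n q) +
            dist (x (N n) (i n) + T n q) (x (N n) (i n) + T₀ q) := dist_triangle _ _ _
      _ = dist (x (N n) j) (x (N n) (i n) + T n q) + ‖T n q - T₀ q‖ := by
          rw [dist_add_left, dist_eq_norm (T n q) (T₀ q)]
      _ ≤ 1 / ((n : ℝ) + 5) + η * ‖q‖ := add_le_add hj (hTv q)
      _ ≤ ε / 2 + η * R' := by gcongr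
      _ = ε := by
          rw [hηR']
          ring
  refine ⟨N n, hkM.trans (hkn.trans (hN n)), -x (N n) (i n), ?_, ?_⟩
  · -- every site of `P` in the ball is near a particle
    intro s hs hsR
    obtain ⟨q, hq, rfl⟩ := (hpts s).1 hs
    have hqR : ‖q‖ ≤ R := by rwa [hT₀ q] at hsR
    have hqn : ‖q‖ ≤ (n : ℝ) + 1 := by linarith
    obtain ⟨j, hj⟩ := hW1 n q hq hqn
    exact ⟨j, hclose j q hj (by linarith)⟩
  · -- every particle in the ball is near a site of `P`
    intro j hj
    have hjR : dist (x (N n) j) (x (N n) (i n)) ≤ R := by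
      rwa [dist_eq_norm, sub_eq_add_neg]
    have hjn : dist (x (N n) j) (x (N n) (i n)) ≤ (n : ℝ) + 1 := by linarith
    obtain ⟨q, hq, hjq⟩ := hW2 n j hjn
    have hqR' : ‖q‖ ≤ R' := by
      have h1 : ‖q‖ = dist (x (N n) (i n) + T n q) (x (N n) (i n)) := by
        rw [dist_eq_norm, add_sub_cancel_left, hT n]
      have h2 := dist_triangle_left (x (N n) (i n) + T n q) (x (N n) (i n)) (x (N n) j)
      linarith
    exact ⟨T₀ q, (hpts _).2 ⟨q, hq, rfl⟩, hclose j q hjq hqR'⟩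

end Summit.AtomisticToContinuum.Crystallization.Theorems.PeriodicWindowsSketch

end
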